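import Summits.CriticalPhenomena.PercolationContinuityZ3.Theorems.PercNearOneGluingNoHeavyQuantKappaIntegral
import Mathlib.Analysis.Convex.Slope
import HarnessLib

/-!
# `κ` is CONVEX on `[0,1]` (Aizenman–Kesten–Newman 1987, Prop. 1.4 (i): "f is a convex function of p")
# — quant lane, METHOD = differential inequalities, seat p4 gen 10, file 6

builds on p205010 (kernel theorem, internal audit signed; external expert review pending).
Status sentence for p205010: "θ(p_c) = 0 on ℤ^d, all d ≥ 2 — kernel-verified (Lean 4/Mathlib, standard axioms); internal
adversarial audit SIGNED 2026-08-20 04:29Z; external expert review pending."  (Nothing in THIS file uses p205010.)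

Seat `prim-quant-p4`, `--supports stmt-CriticalPhenomena-4575`; pure proofs, no definitions (`local notation3` only).
From file 4 (`Kappa.kappa_sub_kappa_eq_integral`): `κ(prm y) − κ(prm x) = −∫_x^y G` with
`G(r) = Σ_i P_{prm r}(0 ↮ e_i in ℤ^d \ {0,e_i})` ANTITONE (`Kappa.sepTotal_antitone`: separation off an edge is a decreasing
event).  Hence adjacent slopes increase — `(κ(y)−κ(x))/(y−x) ≤ −G(y) ≤ (κ(z)−κ(y))/(z−y)` for `x < y < z` — and
**`Kappa.kappa_convexOn : ConvexOn ℝ (Icc 0 1) (κ ∘ prm)`** (AKN: "the convexity of f seems not to have been noted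
previously"); no uniqueness of the infinite cluster is needed.  `Kappa.slope_kappa_le`, `Kappa.le_slope_kappa` are the two
one-sided slope bounds (the content of AKN's one-sided derivative formulas (1.5)–(1.6) before identifying the limits).

## References
* M. Aizenman, H. Kesten, C. M. Newman, Comm. Math. Phys. 111 (1987) 505–531: Prop. 1.4 (i), Remark (v), Lemma 2.2
  [AizenmanKestenNewmanCMP1987].
* G. Grimmett, *Percolation*, 2nd ed. (1999), §4.3 [GrimmettPercolation1999].
-/

noncomputable section

namespace Summit.CriticalPhenomena.PercolationContinuityZ3.Theorems

open MeasureTheory Set Filter Topology Literature.Probability.Percolation Literature.Probability.LatticeModels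

/-- `σ_i(p) = P_p(0 ↮ e_i in ℤ^d \ {0, e_i})` -/
local notation3 "SEP[" d ", " i ", " p "]" =>
  ((bondPercolation (zdGraph d) p).real
    {ω | ω \ {s((0 : Site d), Pi.single i 1)} ∉ openConn (0 : Site d) (Pi.single i 1)})

namespace Kappa

variable {d : ℕ}

/-- **Upper slope bound**: for `0 ≤ x < y ≤ 1`, `(κ(prm y) − κ(prm x))/(y − x) ≤ −Σ_i σ_i(prm y)` (the integrand is
antitone, so its average over `[x,y]` is at least its value at `y`). [cite: AizenmanKestenNewmanCMP1987, Prop. 1.4 (i)] -/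
theorem slope_kappa_le {x y : ℝ} (hx : 0 ≤ x) (hxy : x < y) (hy : y ≤ 1) :
    (kappa (zdGraph d) 0 (GhostField.prm y) - kappa (zdGraph d) 0 (GhostField.prm x)) / (y - x) ≤
      -(∑ i : Fin d, SEP[d, i, GhostField.prm y]) := by
  have h := kappa_sub_kappa_eq_integral (d := d) hx hxy.le hy
  have hG : IntervalIntegrable (fun r : ℝ => ∑ i : Fin d, SEP[d, i, GhostField.prm r]) volume x y :=
    ((sepTotal_antitone (d := d)).antitoneOn _).intervalIntegrable
  have hint : (y - x) * ∑ i : Fin d, SEP[d, i, GhostField.prm y] ≤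
      ∫ r in x..y, ∑ i : Fin d, SEP[d, i, GhostField.prm r] := by
    have := intervalIntegral.integral_mono_on hxy.le
      (_root_.intervalIntegrable_const (μ := volume) (c := ∑ i : Fin d, SEP[d, i, GhostField.prm y])) hG
      (fun r hr => sepTotal_antitone (d := d) hr.2)
    rwa [intervalIntegral.integral_const, smul_eq_mul] at this
  rw [div_le_iff₀ (by linarith), h]
  nlinarith

/-- **Lower slope bound**: for `0 ≤ y < z ≤ 1`, `−Σ_i σ_i(prm y) ≤ (κ(prm z) − κ(prm y))/(z − y)`.
[cite: AizenmanKestenNewmanCMP1987, Prop. 1.4 (i)] -/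
theorem le_slope_kappa {y z : ℝ} (hy : 0 ≤ y) (hyz : y < z) (hz : z ≤ 1) :
    -(∑ i : Fin d, SEP[d, i, GhostField.prm y]) ≤
      (kappa (zdGraph d) 0 (GhostField.prm z) - kappa (zdGraph d) 0 (GhostField.prm y)) / (z - y) := by
  have h := kappa_sub_kappa_eq_integral (d := d) hy hyz.le hz
  have hG : IntervalIntegrable (fun r : ℝ => ∑ i : Fin d, SEP[d, i, GhostField.prm r]) volume y z :=
    ((sepTotal_antitone (d := d)).antitoneOn _).intervalIntegrable
  have hint : ∫ r in y..z, ∑ i : Fin d, SEP[d, i, GhostField.prm r] ≤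
      (z - y) * ∑ i : Fin d, SEP[d, i, GhostField.prm y] := by
    have := intervalIntegral.integral_mono_on hyz.le hG
      (_root_.intervalIntegrable_const (μ := volume) (c := ∑ i : Fin d, SEP[d, i, GhostField.prm y]))
      (fun r hr => sepTotal_antitone (d := d) hr.1)
    rwa [intervalIntegral.integral_const, smul_eq_mul] at this
  rw [le_div_iff₀ (by linarith), h]
  nlinarith

/-- **AKN Prop. 1.4 (i): `κ` is convex on `[0,1]`** (adjacent slopes increase through `−Σ_i σ_i`, which is monotone
because separation off an edge is a decreasing event).  No uniqueness of the infinite cluster is used.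
[cite: AizenmanKestenNewmanCMP1987, Prop. 1.4 (i) and Remark (v)] -/
theorem kappa_convexOn : ConvexOn ℝ (Set.Icc (0 : ℝ) 1) (fun r : ℝ => kappa (zdGraph d) 0 (GhostField.prm r)) := by
  refine convexOn_of_slope_mono_adjacent (convex_Icc 0 1) fun {x y z} hx hz hxy hyz => ?_
  exact (slope_kappa_le hx.1 hxy (hyz.le.trans hz.2)).trans (le_slope_kappa (hx.1.trans hxy.le) hyz hz.2)

/-- The slope sandwich at a point: for `0 ≤ x < y < z ≤ 1`,
`(κ(y)−κ(x))/(y−x) ≤ −Σ_i σ_i(y) ≤ (κ(z)−κ(y))/(z−y)` — `−Σ_i σ_i(y)` lies between the left and right difference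
quotients at `y` (AKN (1.5)–(1.6) before the limits are identified). [cite: AizenmanKestenNewmanCMP1987, Prop. 1.4 (1.5)–(1.6)] -/
theorem slope_kappa_sandwich {x y z : ℝ} (hx : 0 ≤ x) (hxy : x < y) (hyz : y < z) (hz : z ≤ 1) :
    (kappa (zdGraph d) 0 (GhostField.prm y) - kappa (zdGraph d) 0 (GhostField.prm x)) / (y - x) ≤
        -(∑ i : Fin d, SEP[d, i, GhostField.prm y]) ∧
      -(∑ i : Fin d, SEP[d, i, GhostField.prm y]) ≤
        (kappa (zdGraph d) 0 (GhostField.prm z) - kappa (zdGraph d) 0 (GhostField.prm y)) / (z - y) :=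
  ⟨slope_kappa_le hx hxy (hyz.le.trans hz), le_slope_kappa (hx.trans hxy.le) hyz hz⟩

end Kappa

end Summit.CriticalPhenomena.PercolationContinuityZ3.Theorems

end
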